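import Mathlib
import Literature.Computability.AlgebraicComplexity.LinSubst

/-!
# Border apolarity, crux `FixedWitnessObstructionQP` — the two elementary families of `H₀(n,m)`

Route `ValiantsHypothesis/BorderApolarity`, crux item `stmt-ValiantsHypothesis-5778`, line
`cone-purity-squeeze`, stub `stub_h0Elementary`.  The stability clause W4 of a fixed witness says:
every invertible matrix `M` on the `m²` variables `Fin m × Fin m` which is (a) triangular for the
total order `rk` ("own" variables — `ℓ = (0,0)` and the `Y`-block `{v | m-n ≤ v.1 ∧ m-n ≤ v.2}` —
first, the unused `z`-variables last), (b) diagonal on the own columns, (c) rank-one on the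
`Y`-diagonal and (d) of character `M₀₀^{m-n} · ∏_{block i} M_{(ii)(ii)} = 1`, maps each `J k`
(`k ≤ m`) into itself by `D ↦ linSubst Mᵀ D`.  Cone purity only consumes two one-parameter
families of such matrices, extracted here:

* `∂_y ↦ ∂_y + c ∂_z` (`y` own, `z` unused, any `c`): the matrix `1 + c • single z y 1` is the
  transpose of the transvection `M = 1 + single y z c`; its only off-diagonal entry sits at `(y, z)`
  with `rk y < m² ≤ rk z`, own columns stay diagonal, all diagonal entries are `1`;
* the `z`-torus `diagonal (update 1 z d)`, `d ≠ 0`: symmetric, diagonal, all own diagonal entries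
  are `1`.

Pure bookkeeping: exhibit the matrix as an element of `GL` (`det = 1`, resp. `det = d`) and check
the four clauses against the `if`-defined order `rk`.
-/

open MvPolynomial Filter
open scoped BigOperators Matrix
open Literature.Computability.AlgebraicComplexity

namespace Summit.ValiantsHypothesis.ValiantsHypothesis.Theorems.BorderApolarityFixedWitnessObstructionQP

/-- The positional weight of a variable `y : Fin m × Fin m` is below `m²`:
`y.1 * m + y.2 < m * m`. [folklore] -/
theorem fst_mul_add_snd_lt {m : ℕ} (y : Fin m × Fin m) : (y.1 : ℕ) * m + (y.2 : ℕ) < m * m := by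
  have h1 := y.1.isLt
  have h2 := y.2.isLt
  calc (y.1 : ℕ) * m + (y.2 : ℕ) < (y.1 : ℕ) * m + m := by omega
    _ = ((y.1 : ℕ) + 1) * m := by ring
    _ ≤ m * m := Nat.mul_le_mul_right m h1

/-- **The two one-parameter families cone purity consumes lie in `H₀(n,m)` (W4 ⇒ `hzif ∧ htor`).**
From the stability clause W4 (every invertible `M` that is triangular for the `rk` order "own
variables first, unused last", diagonal on the own columns, rank-one on the `Y`-diagonal and of
character `M₀₀^{m-n} ∏ M_{(ii)(ii)} = 1` maps `J k` into itself by `D ↦ linSubst Mᵀ D`, `k ≤ m`) we get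
stability of each `J k`, `k ≤ m`, under `linSubst (1 + c • single z y 1)` (`y` own, `z` unused, any
`c`; take `M = transvection y z c`: the entry `(y,z)` is allowed since `rk y < m² ≤ rk z`, own columns
stay diagonal, all diagonal entries are `1`, `det M = 1`) and under `linSubst (diagonal (update 1 z d))`,
`d ≠ 0` (symmetric, diagonal, own diagonal entries `1`, `det = d`). [folklore] -/
theorem stub_h0Elementary (n m : ℕ) [NeZero m] (J : ℕ → Set (MvPolynomial (Fin m × Fin m) ℂ))
    (hW4 : ∀ A : Matrix.GeneralLinearGroup (Fin m × Fin m) ℂ,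
      let M : Matrix (Fin m × Fin m) (Fin m × Fin m) ℂ := A
      let rk := fun (p : Fin m × Fin m) =>
        (if (m - n ≤ (p.1 : ℕ) ∧ m - n ≤ (p.2 : ℕ)) ∨ p = (0, 0) then 0 else m * m) + ((p.1 : ℕ) * m + (p.2 : ℕ))
      (∀ i j : Fin m × Fin m, M j i ≠ 0 → rk j ≤ rk i) →
      (∀ i j : Fin m × Fin m, ((m - n ≤ (i.1 : ℕ) ∧ m - n ≤ (i.2 : ℕ)) ∨ i = (0, 0)) → j ≠ i → M j i = 0) →
      (∀ i k j l : Fin m, m - n ≤ (i : ℕ) → m - n ≤ (k : ℕ) → m - n ≤ (j : ℕ) → m - n ≤ (l : ℕ) →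
        M (i, j) (i, j) * M (k, l) (k, l) = M (i, l) (i, l) * M (k, j) (k, j)) →
      M (0, 0) (0, 0) ^ (m - n) * ∏ i ∈ Finset.univ.filter (fun i : Fin m => m - n ≤ (i : ℕ)), M (i, i) (i, i) = 1 →
      ∀ k ≤ m, ∀ D ∈ J k, linSubst (Fin m × Fin m) ℂ Mᵀ D ∈ J k) :
    ∀ k ≤ m,
      (∀ y z : Fin m × Fin m,
        ((m - n ≤ (y.1 : ℕ) ∧ m - n ≤ (y.2 : ℕ)) ∨ y = (0, 0)) →
        ¬ ((m - n ≤ (z.1 : ℕ) ∧ m - n ≤ (z.2 : ℕ)) ∨ z = (0, 0)) →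
        ∀ c : ℂ, ∀ D ∈ J k, linSubst (Fin m × Fin m) ℂ (1 + c • Matrix.single z y (1 : ℂ)) D ∈ J k) ∧
      (∀ z : Fin m × Fin m,
        ¬ ((m - n ≤ (z.1 : ℕ) ∧ m - n ≤ (z.2 : ℕ)) ∨ z = (0, 0)) →
        ∀ d : ℂ, d ≠ 0 → ∀ D ∈ J k,
          linSubst (Fin m × Fin m) ℂ (Matrix.diagonal (Function.update 1 z d)) D ∈ J k) := by
  intro k hk
  constructor
  · -- Family 1: `∂_y ↦ ∂_y + c ∂_z`, the transpose of the transvection `1 + single y z c`.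
    intro y z hy hz c D hD
    have hyz : y ≠ z := fun h => hz (h ▸ hy)
    have hT : (1 + c • Matrix.single z y (1 : ℂ)) = (Matrix.transvection y z c)ᵀ := by
      rw [Matrix.transvection, Matrix.transpose_add, Matrix.transpose_one, Matrix.transpose_single,
        Matrix.smul_single, smul_eq_mul, mul_one]
    have hdet : (Matrix.transvection y z c).det ≠ 0 := by
      rw [Matrix.det_transvection_of_ne _ _ hyz]
      exact one_ne_zero
    -- all diagonal entries of the transvection are `1`
    have hdiag : ∀ p, Matrix.transvection y z c p p = 1 := fun p => by
      rw [Matrix.transvection, Matrix.add_apply, Matrix.one_apply_eq, Matrix.single_apply,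
        if_neg (fun h => hyz (h.1.trans h.2.symm)), add_zero]
    have h := hW4 (Matrix.GeneralLinearGroup.mkOfDetNeZero _ hdet)
    simp only [Matrix.GeneralLinearGroup.val_mkOfDetNeZero] at h
    rw [hT]
    refine h ?_ ?_ ?_ ?_ k hk D hD
    · -- (a) triangularity for `rk`: the only off-diagonal entry is `(y, z)`, and `rk y < m² ≤ rk z`
      intro i j hij
      by_cases hji : j = i
      · subst hji
        exact le_rfl
      · rw [Matrix.transvection, Matrix.add_apply, Matrix.one_apply_ne hji, zero_add,
          Matrix.single_apply] at hij
        by_cases hyj : y = j ∧ z = i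
        · have hlt := fst_mul_add_snd_lt y
          obtain ⟨rfl, rfl⟩ := hyj
          rw [if_pos hy, if_neg hz, zero_add]
          omega
        · exact (hij (if_neg hyj)).elim
    · -- (b) own columns are diagonal: an entry `(j, i) = (y, z)` would make `z = i` own
      intro i j hi hji
      rw [Matrix.transvection, Matrix.add_apply, Matrix.one_apply_ne hji, zero_add,
        Matrix.single_apply, if_neg]
      rintro ⟨-, rfl⟩
      exact hz hi
    · -- (c) rank-one pattern on the `Y`-diagonal: all diagonal entries are `1`
      intro i k' j l _ _ _ _
      simp only [hdiag]
    · -- (d) character `1`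
      simp only [hdiag, one_pow, one_mul, Finset.prod_const_one]
  · -- Family 2: the `z`-torus `diagonal (update 1 z d)`.
    intro z hz d hd D hD
    have hdet : (Matrix.diagonal (Function.update (1 : Fin m × Fin m → ℂ) z d)).det ≠ 0 := by
      rw [Matrix.det_diagonal, Finset.prod_update_of_mem (Finset.mem_univ z)]
      simpa using hd
    -- the diagonal entries at own positions are `1`
    have hdiag : ∀ p : Fin m × Fin m, ((m - n ≤ (p.1 : ℕ) ∧ m - n ≤ (p.2 : ℕ)) ∨ p = (0, 0)) →
        Matrix.diagonal (Function.update (1 : Fin m × Fin m → ℂ) z d) p p = 1 := fun p hp => by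
      have hpz : p ≠ z := fun h => hz (h ▸ hp)
      rw [Matrix.diagonal_apply_eq, Function.update_of_ne hpz, Pi.one_apply]
    have h := hW4 (Matrix.GeneralLinearGroup.mkOfDetNeZero _ hdet)
    simp only [Matrix.GeneralLinearGroup.val_mkOfDetNeZero, Matrix.diagonal_transpose] at h
    refine h ?_ ?_ ?_ ?_ k hk D hD
    · -- (a) diagonal matrices are triangular
      intro i j hij
      by_cases hji : j = i
      · subst hji
        exact le_rfl
      · exact (hij (Matrix.diagonal_apply_ne _ hji)).elim
    · -- (b) diagonal
      intro i j _ hji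
      exact Matrix.diagonal_apply_ne _ hji
    · -- (c) the `Y`-diagonal entries are `1`
      intro i k' j l hi hk' hj hl
      rw [hdiag _ (Or.inl ⟨hi, hj⟩), hdiag _ (Or.inl ⟨hk', hl⟩), hdiag _ (Or.inl ⟨hi, hl⟩),
        hdiag _ (Or.inl ⟨hk', hj⟩)]
    · -- (d) character `1`
      rw [hdiag _ (Or.inr rfl), one_pow, one_mul]
      exact Finset.prod_eq_one fun i hi =>
        hdiag _ (Or.inl ⟨(Finset.mem_filter.mp hi).2, (Finset.mem_filter.mp hi).2⟩)

end Summit.ValiantsHypothesis.ValiantsHypothesis.Theorems.BorderApolarityFixedWitnessObstructionQP
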